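import Literature.NumberTheory.EllipticCurves.Sprung2017.TraceCoordinateFunctionalEquation
import Literature.NumberTheory.EllipticCurves.Sprung2017.SharpFlatCombinationFunctionalEquationProofs
import Literature.NumberTheory.EllipticCurves.Sprung2017.SharpFlatPAdicLFunctionProofs
import Literature.NumberTheory.EllipticCurves.PAdicLFunctionProofs
import Literature.NumberTheory.EllipticCurves.PAdicLFunctionNeZeroProofs
import HarnessLib

/-!
# Sprung 2017, Thm. 1.1 + Thm. 4.13 / Cor. 4.14 at `(p, a_p) = (3, ±3)`: the functional equation of the
# TRACE COORDINATES `(G₁, G₂) = (L♯, L♭)·ℒ` — PROOF of the named fact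
# `thm413_traceCoordinate_functionalEquation_three`

A *proofs* companion (theorems only; no definition, no named fact) of `TraceCoordinateFunctionalEquation`
(the fact), `HalfLogarithmMatrix{,Limit}` (the approximants `A_n = 𝒞_1⋯𝒞_n C^{−(n+2)}` and their
coefficientwise `3`-adic limit `ℒ = halfLogMatrix b`), `SharpFlatCombinationFunctionalEquationProofs`
(`Y_n(T^ι) − σ(1+T)^c Y_n ∈ ω_n Λ` for `Y_n = u_n L♯ + v_n L♭`) and `SharpFlatPAdicLFunctionProofs`
(`3`-integrality of the plus symbols when `a_3 ≢ 1 (mod 3)`).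

## The proof (not Sprung's `α`-route: finite level + the limit matrix)

For a Sprung pair `(L♯, L♭)` at `(3, 3b)` put `Y_m := u_m L♯ + v_m L♭ ∈ Λ` and
`G_j := L♯ ℒ_{0j} + L♭ ℒ_{1j} ∈ ℚ_3⟦T⟧`. Since `(A_n)_{ij} = x^{(i)}_{n+1}(C^{−(n+2)})_{0j} +
x^{(i)}_n (C^{−(n+2)})_{1j}` with `x^{(0)} = u`, `x^{(1)} = v`,
`L♯ (A_n)_{0j} + L♭ (A_n)_{1j} = Y_{n+1}·(C^{−(n+2)})_{0j} + Y_n·(C^{−(n+2)})_{1j}` (§2), and these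
approximants converge to `G_j` coefficient by coefficient (`tendsto_coeffSeq`). The defect
`Φ(h) := h(T^ι) − σ(1+T)^c·h` is `ℚ_3`-linear and each coefficient of `Φ(h)` is a FINITE linear form in the
coefficients of `h` (§1), so `coeff_j Φ(approximant_n) → coeff_j Φ(G_j)`. On the other hand
`Φ(approximant_n) = ω_{n+1}e_{n+1}·(C^{−(n+2)})_{0j} + ω_n e_n·(C^{−(n+2)})_{1j}` with `e_m ∈ Λ`
(`IsSprungPair.exists_subst_sub_mul_eq_omega_mul`), and Kummer's congruence `3^{m − ⌊log₃ j⌋} ∣ C(3^m, s)`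
(`1 ≤ s ≤ j`) with `3^{⌈(n+2)/2⌉}C^{−(n+2)} ∈ M₂(ℤ)` (`three_pow_smul_sprungCinv_pow`) bound its `j`-th
coefficient by `3^{⌊log₃ j⌋ + 2 − ⌊n/2⌋} → 0` (§3). Hence `Φ(G_j) = 0` (§4):
**`thm413_traceCoordinate_functionalEquation_three_holds`**. The integrality input
(`‖[a/3^k]⁺_f‖₃ ≤ 1` at `a_3 = ±3`) is `norm_ratPlusSymbol_div_pow_le_one_of_not_dvd` (Cor. 4.10).

HONEST FRAMING: this discharges the single named-fact hypothesis of the Summits-side theorem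
`ClassX8.sharp_ne_zero_and_flat_ne_zero_of_traceFE` (both colours non-zero on class X8 = Sprung 2017
Conj. 4.12 / 2012 Conj. 6.15 at `(3, ±3)`); it is the special case `p = 3`, `a_3 = ±3`, `i = 0` of print
and never stronger. BSD is not proved by any of this.

## References

* F. Sprung, *On pairs of `p`-adic `L`-functions for weight-two modular forms*, Algebra & Number Theory 11
  (2017): Thm. 1.1 and §3.1 (the matrix `Log_{α,β} = lim 𝒞_1⋯𝒞_n C^{−(n+2)}(−1 −1; β α)`), Cor. 4.4
  (the congruences), Cor. 4.10 (integrality), Thm. 4.13 / Cor. 4.14 (functional equation, "formally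
  display exactly the same invariance under `T ↦ 1/(1+T) − 1`, cf. [mtt]"). [Sprung2017]
* B. Mazur, J. Tate, J. Teitelbaum, Invent. Math. 84 (1986), §I.17. [MazurTateTeitelbaum1986Invent]
-/

noncomputable section

open scoped MatrixGroups ModularForm

open CongruenceSubgroup PowerSeries Filter Topology WeierstrassCurve
  Literature.NumberTheory.EllipticCurves.ModularForms Literature.Barriers.BirchSwinnertonDyer

namespace Literature.NumberTheory.EllipticCurves.Sprung2017

/-! ## §1 Coefficientwise continuity of products and of the substitution `T ↦ T^ι` -/

section Continuity

variable {p : ℕ} [Fact p.Prime]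

/-- `[T^e] G(ω) = Σ_{d ≤ e} [T^d]G · [T^e]ω^d` for `ω(0) = 0` (private plumbing). [folklore] -/
private theorem coeff_subst_eq_sum_range {R : Type*} [CommRing R] {ω : R⟦X⟧} (hω : constantCoeff ω = 0)
    (G : R⟦X⟧) (e : ℕ) :
    coeff e (G.subst ω) = ∑ d ∈ Finset.range (e + 1), coeff d G * coeff e (ω ^ d) := by
  rw [coeff_subst' (HasSubst.of_constantCoeff_zero' hω),
    finsum_eq_sum_of_support_subset _ (s := Finset.range (e + 1)) ?_]
  · simp only [smul_eq_mul]
  · intro d hd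
    simp only [Function.mem_support, ne_eq, Finset.coe_range, Set.mem_Iio] at hd ⊢
    by_contra hlt
    apply hd
    rw [coeff_of_lt_order e (lt_of_lt_of_le (by exact_mod_cast (by omega : e < d))
      (natCast_le_order_pow hω d)), smul_zero]

/-- **Coefficientwise continuity of the functional-equation defect** `Φ(h) = h(T^ι) − κ·h`: each
coefficient of `Φ(h)` is a finite `ℚ_p`-linear form in the coefficients of `h`, so coefficientwise
convergence `h_n → h` gives `coeff_j Φ(h_n) → coeff_j Φ(h)` (private plumbing). [folklore] -/
private theorem tendsto_coeff_defect (κ : ℚ_[p]⟦X⟧) {g : ℕ → ℚ_[p]⟦X⟧} {g₀ : ℚ_[p]⟦X⟧}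
    (hg : ∀ j, Tendsto (fun n => coeff j (g n)) atTop (𝓝 (coeff j g₀))) (j : ℕ) :
    Tendsto (fun n => coeff j ((g n).subst (invOnePlusSubOne : ℚ_[p]⟦X⟧) - κ * g n)) atTop
      (𝓝 (coeff j (g₀.subst (invOnePlusSubOne : ℚ_[p]⟦X⟧) - κ * g₀))) := by
  have h0 : constantCoeff (invOnePlusSubOne : ℚ_[p]⟦X⟧) = 0 := constantCoeff_invOnePlusSubOne
  simp_rw [map_sub, coeff_subst_eq_sum_range h0, coeff_mul]
  exact (tendsto_finsetSum _ fun d _ => (hg d).mul_const _).sub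
    (tendsto_finsetSum _ fun x _ => (hg x.2).const_mul _)

end Continuity

/-! ## §2 The approximants of the trace coordinates at `(p, a) = (3, 3b)` -/

section Approximants

/-- `ι_Λ(u) = u` for the image `u` of an integer polynomial (private plumbing). [folklore] -/
private theorem iwasawaToPowerSeries_toIwasawa {p : ℕ} [Fact p.Prime] (q : Polynomial ℤ) :
    iwasawaToPowerSeries p (toIwasawa p q) =
      ((q.map (Int.castRingHom ℚ_[p]) : Polynomial ℚ_[p]) : ℚ_[p]⟦X⟧) := by
  change PowerSeries.map (algebraMap ℤ_[p] ℚ_[p])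
    (((q.map (Int.castRingHom ℤ_[p])) : Polynomial ℤ_[p]) : ℤ_[p]⟦X⟧) = _
  rw [← Polynomial.polynomial_map_coe, Polynomial.map_map,
    RingHom.ext_int ((algebraMap ℤ_[p] ℚ_[p]).comp (Int.castRingHom ℤ_[p])) (Int.castRingHom ℚ_[p])]

/-- An integer polynomial read in `ℚ_3⟦T⟧` through `ℚ` is its image through `Λ` (private plumbing).
[folklore] -/
private theorem coe_map_map_eq_iwasawaToPowerSeries (q : Polynomial ℤ) :
    (((q.map (Int.castRingHom ℚ)).map (algebraMap ℚ ℚ_[3]) : Polynomial ℚ_[3]) : ℚ_[3]⟦X⟧) =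
      iwasawaToPowerSeries 3 (toIwasawa 3 q) := by
  rw [iwasawaToPowerSeries_toIwasawa, Polynomial.map_map,
    RingHom.ext_int ((algebraMap ℚ ℚ_[3]).comp (Int.castRingHom ℚ)) (Int.castRingHom ℚ_[3])]

variable (b : ℤ)

/-- The coefficients of the approximant `(A_n)_{ij}` read in `ℚ_3⟦T⟧` are the `coeffSeq`.
[cite: Sprung2017, §3.1 (the partial products 𝒞_1⋯𝒞_n C^{−(n+2)})] -/
theorem coeff_coe_map_halfLogApprox (n : ℕ) (i j : Fin 2) (k : ℕ) :
    coeff k ((((halfLogApprox 3 (3 * b) n i j).map (algebraMap ℚ ℚ_[3])) : Polynomial ℚ_[3]) :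
      ℚ_[3]⟦X⟧) = coeffSeq b n i j k := by
  rw [coeffSeq, Polynomial.coeff_coe, Polynomial.coeff_map, eq_ratCast]

/-- **The approximants of the trace coordinates are the combinations `Y_{n+1}, Y_n`**:
`L♯·(A_n)_{0j} + L♭·(A_n)_{1j} = Y_{n+1}·(C^{−(n+2)})_{0j} + Y_n·(C^{−(n+2)})_{1j}` with
`Y_m = u_m L♯ + v_m L♭` (rows of `𝒞_1⋯𝒞_n = (u_{n+1} u_n; v_{n+1} v_n)`).
[cite: Sprung2017, Thm. 1.1 and Cor. 4.4 ((L_α, L_β) = (L♯, L♭)·Log, first column of 𝒞_1⋯𝒞_n Ã⁻¹)] -/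
theorem sum_mul_coe_map_halfLogApprox (Ls Lf : IwasawaAlgebra 3) (n : ℕ) (j : Fin 2) :
    iwasawaToPowerSeries 3 Ls *
        ((((halfLogApprox 3 (3 * b) n 0 j).map (algebraMap ℚ ℚ_[3])) : Polynomial ℚ_[3]) : ℚ_[3]⟦X⟧) +
      iwasawaToPowerSeries 3 Lf *
        ((((halfLogApprox 3 (3 * b) n 1 j).map (algebraMap ℚ ℚ_[3])) : Polynomial ℚ_[3]) : ℚ_[3]⟦X⟧) =
    iwasawaToPowerSeries 3 (toIwasawa 3 (sharpPoly (3 * b) 3 (n + 1)) * Ls +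
          toIwasawa 3 (flatPoly (3 * b) 3 (n + 1)) * Lf) *
        PowerSeries.C ((((sprungCinv 3 (3 * b)) ^ (n + 2)) 0 j : ℚ) : ℚ_[3]) +
      iwasawaToPowerSeries 3 (toIwasawa 3 (sharpPoly (3 * b) 3 n) * Ls +
          toIwasawa 3 (flatPoly (3 * b) 3 n) * Lf) *
        PowerSeries.C ((((sprungCinv 3 (3 * b)) ^ (n + 2)) 1 j : ℚ) : ℚ_[3]) := by
  simp only [halfLogApprox, Polynomial.map_add, Polynomial.map_mul, Polynomial.map_C, Polynomial.coe_add,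
    Polynomial.coe_mul, Polynomial.coe_C, coe_map_map_eq_iwasawaToPowerSeries, rowSeq_zero, rowSeq_one,
    map_add, map_mul, eq_ratCast]
  ring

/-- **Coefficientwise convergence of the approximants to the trace coordinate**
`G_j = L♯ ℒ_{0j} + L♭ ℒ_{1j}` (`ℒ = lim A_n` coefficientwise, `tendsto_coeffSeq`).
[cite: Sprung2017, §3.1 Lemma 3.3 and Thm. 1.1] -/
theorem tendsto_coeff_sum_mul_coe_map_halfLogApprox (Ls Lf : IwasawaAlgebra 3) (j : Fin 2) (k : ℕ) :
    Tendsto (fun n => coeff k (iwasawaToPowerSeries 3 Ls *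
        ((((halfLogApprox 3 (3 * b) n 0 j).map (algebraMap ℚ ℚ_[3])) : Polynomial ℚ_[3]) : ℚ_[3]⟦X⟧) +
      iwasawaToPowerSeries 3 Lf *
        ((((halfLogApprox 3 (3 * b) n 1 j).map (algebraMap ℚ ℚ_[3])) : Polynomial ℚ_[3]) : ℚ_[3]⟦X⟧)))
      atTop (𝓝 (coeff k (iwasawaToPowerSeries 3 Ls * halfLogMatrix b 0 j +
        iwasawaToPowerSeries 3 Lf * halfLogMatrix b 1 j))) := by
  simp_rw [map_add, coeff_mul, coeff_coe_map_halfLogApprox]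
  exact (tendsto_finsetSum _ fun x _ => (tendsto_coeffSeq b 0 j x.2).const_mul _).add
    (tendsto_finsetSum _ fun x _ => (tendsto_coeffSeq b 1 j x.2).const_mul _)

end Approximants

/-! ## §3 The `3`-adic size of the defect of the approximants -/

section Estimates

/-- Kummer at a prime power: `3^{n − ⌊log₃ s⌋} ∣ C(3ⁿ, s)` for `1 ≤ s` (private plumbing). [folklore] -/
private theorem pow_dvd_choose_three_pow (n s : ℕ) (hs : 1 ≤ s) :
    3 ^ (n - Nat.log 3 s) ∣ Nat.choose (3 ^ n) s := by
  rcases le_or_gt s (3 ^ n) with hle | hlt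
  · have hfac := Nat.factorization_choose_prime_pow Nat.prime_three hle (by omega)
    have hv : s.factorization 3 ≤ Nat.log 3 s := by
      apply Nat.le_log_of_pow_le (by norm_num)
      exact Nat.ordProj_le 3 (by omega)
    calc 3 ^ (n - Nat.log 3 s) ∣ 3 ^ (n - s.factorization 3) := pow_dvd_pow 3 (by omega)
      _ = 3 ^ ((Nat.choose (3 ^ n) s).factorization 3) := by rw [hfac]
      _ ∣ Nat.choose (3 ^ n) s := Nat.ordProj_dvd _ _
  · rw [Nat.choose_eq_zero_of_lt hlt]
    exact dvd_zero _

/-- The coefficients of `ω_n = (1+T)^{3ⁿ} − 1 ∈ Λ` in degrees `s ≤ j` are divisible by `3^{n − ⌊log₃ j⌋}`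
(private plumbing). [folklore] -/
private theorem pow_dvd_coeff_omega (n j s : ℕ) (hsj : s ≤ j) :
    (3 : ℤ_[3]) ^ (n - Nat.log 3 j) ∣ coeff s ((1 + X : ℤ_[3]⟦X⟧) ^ (3 ^ n) - 1) := by
  rw [← coe_map_cyclotomicOmega, Polynomial.coeff_coe, Polynomial.coeff_map, cyclotomicOmega]
  have hZ : (3 : ℤ) ^ (n - Nat.log 3 j) ∣ ((Polynomial.X + 1 : Polynomial ℤ) ^ 3 ^ n - 1).coeff s := by
    rcases Nat.eq_zero_or_pos s with rfl | hs
    · rw [Polynomial.coeff_sub, Polynomial.coeff_X_add_one_pow, Nat.choose_zero_right, Nat.cast_one,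
        Polynomial.coeff_one_zero, sub_self]
      exact dvd_zero _
    · rw [Polynomial.coeff_sub, Polynomial.coeff_X_add_one_pow, Polynomial.coeff_one, if_neg (by omega),
        sub_zero]
      have h := pow_dvd_choose_three_pow n s hs
      have hlog : Nat.log 3 s ≤ Nat.log 3 j := Nat.log_mono_right hsj
      calc (3 : ℤ) ^ (n - Nat.log 3 j) ∣ (3 : ℤ) ^ (n - Nat.log 3 s) := pow_dvd_pow 3 (by omega)
        _ ∣ ((Nat.choose (3 ^ n) s : ℕ) : ℤ) := by exact_mod_cast h
  have h := map_dvd (Int.castRingHom ℤ_[3]) hZ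
  simpa using h

/-- **Kummer bound for `ω_n·e`**: for `e ∈ Λ = ℤ_3⟦T⟧`, the `j`-th coefficient of `ω_n·e`, read in `ℚ_3`,
has norm `≤ 3^{−(n − ⌊log₃ j⌋)}` (private plumbing). [folklore] -/
private theorem norm_coeff_omega_mul_le (n j : ℕ) (e : IwasawaAlgebra 3) :
    ‖coeff j (iwasawaToPowerSeries 3 (((1 + X : ℤ_[3]⟦X⟧) ^ (3 ^ n) - 1) * e))‖ ≤
      ((3 : ℝ) ^ (n - Nat.log 3 j))⁻¹ := by
  have hdvd : (3 : ℤ_[3]) ^ (n - Nat.log 3 j) ∣ coeff j ((((1 + X : ℤ_[3]⟦X⟧) ^ (3 ^ n) - 1) * e)) := by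
    rw [coeff_mul]
    refine Finset.dvd_sum fun x hx => ?_
    have hx1 : x.1 ≤ j := by
      have := Finset.HasAntidiagonal.mem_antidiagonal.mp hx
      omega
    exact (pow_dvd_coeff_omega n j x.1 hx1).mul_right _
  obtain ⟨t, ht⟩ := hdvd
  rw [coeff_map, ht, map_mul, map_pow, map_ofNat, PadicInt.algebraMap_apply, norm_mul, norm_pow]
  have h3 : ‖(3 : ℚ_[3])‖ = (3 : ℝ)⁻¹ := by simpa using Padic.norm_p (p := 3)
  rw [h3, inv_pow]
  have ht1 : ‖(t : ℚ_[3])‖ ≤ 1 := PadicInt.norm_le_one t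
  calc ((3 : ℝ) ^ (n - Nat.log 3 j))⁻¹ * ‖(t : ℚ_[3])‖ ≤ ((3 : ℝ) ^ (n - Nat.log 3 j))⁻¹ * 1 := by
        gcongr
    _ = ((3 : ℝ) ^ (n - Nat.log 3 j))⁻¹ := mul_one _

/-- **Denominators of `C^{−(n+2)}`**: `‖(C^{−(n+2)})_{ij}‖₃ ≤ 3^{⌊(n+3)/2⌋}` (`3^{⌈m/2⌉}C^{−m} ∈ M₂(ℤ)`,
`three_pow_smul_sprungCinv_pow`); private plumbing. [folklore] -/
private theorem norm_sprungCinv_pow_le (b : ℤ) (n : ℕ) (i j : Fin 2) :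
    ‖((((sprungCinv 3 (3 * b)) ^ (n + 2)) i j : ℚ) : ℚ_[3])‖ ≤ (3 : ℝ) ^ ((n + 3) / 2) := by
  have hden := congrArg (fun M : Matrix (Fin 2) (Fin 2) ℚ => M i j) (three_pow_smul_sprungCinv_pow b (n + 2))
  simp only [Matrix.smul_apply, smul_eq_mul, RingHom.mapMatrix_apply, Matrix.map_apply, eq_intCast] at hden
  set c : ℚ := (sprungCinv 3 (3 * b) ^ (n + 2)) i j with hc
  have h3 : (3 : ℚ) ^ ((n + 2 + 1) / 2) ≠ 0 := pow_ne_zero _ (by norm_num)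
  have hc' : c = (cinvNum b (n + 2) i j : ℚ) / (3 : ℚ) ^ ((n + 2 + 1) / 2) := by
    rw [eq_div_iff h3, mul_comm, hden]
  have h3norm : ‖(3 : ℚ_[3])‖ = (3 : ℝ)⁻¹ := by simpa using Padic.norm_p (p := 3)
  rw [hc', show n + 2 + 1 = n + 3 from rfl]
  push_cast
  rw [norm_div, norm_pow, h3norm, inv_pow, div_inv_eq_mul]
  calc ‖((cinvNum b (n + 2) i j : ℤ) : ℚ_[3])‖ * (3 : ℝ) ^ ((n + 3) / 2)
      ≤ 1 * (3 : ℝ) ^ ((n + 3) / 2) := by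
        gcongr
        exact Padic.norm_int_le_one _
    _ = (3 : ℝ) ^ ((n + 3) / 2) := one_mul _

/-- `tailBound j n → 0` (private plumbing). [folklore] -/
private theorem tendsto_tailBound (j : ℕ) : Tendsto (tailBound j) atTop (𝓝 0) := by
  have hdiv : Tendsto (fun n : ℕ => n / 2) atTop atTop :=
    tendsto_atTop_atTop.mpr fun b => ⟨2 * b, fun n hn => by omega⟩
  exact tendsto_const_nhds.div_atTop ((tendsto_pow_atTop_atTop_of_one_lt (by norm_num)).comp hdiv)

/-- One term of the defect: `‖coeff_j (ω_m e · c)‖ ≤ tailBound j n` for `m ∈ {n, n+1}` and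
`‖c‖ ≤ 3^{⌊(n+3)/2⌋}` (private plumbing). [folklore] -/
private theorem norm_coeff_omega_mul_mul_C_le {n m : ℕ} (hm : n ≤ m) (j : ℕ) (e : IwasawaAlgebra 3)
    {c : ℚ_[3]} (hc : ‖c‖ ≤ (3 : ℝ) ^ ((n + 3) / 2)) :
    ‖coeff j (iwasawaToPowerSeries 3 (((1 + X : ℤ_[3]⟦X⟧) ^ (3 ^ m) - 1) * e) * PowerSeries.C c)‖ ≤
      tailBound j n := by
  rw [coeff_mul_C, norm_mul]
  have h1 := norm_coeff_omega_mul_le m j e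
  have key : ((3 : ℝ) ^ (m - Nat.log 3 j))⁻¹ * (3 : ℝ) ^ ((n + 3) / 2) ≤ tailBound j n := by
    unfold tailBound
    rw [inv_mul_eq_div, div_le_div_iff₀ (by positivity) (by positivity), ← pow_add, ← pow_add]
    exact pow_le_pow_right₀ (by norm_num) (by omega)
  calc ‖coeff j (iwasawaToPowerSeries 3 (((1 + X : ℤ_[3]⟦X⟧) ^ (3 ^ m) - 1) * e))‖ * ‖c‖
      ≤ ((3 : ℝ) ^ (m - Nat.log 3 j))⁻¹ * (3 : ℝ) ^ ((n + 3) / 2) :=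
        mul_le_mul h1 hc (norm_nonneg _) (by positivity)
    _ ≤ tailBound j n := key

end Estimates

/-! ## §4 The functional equation of the trace coordinates -/

section Main

variable {b : ℤ} {σ : ℤ} {c : ℤ_[3]} {Ls Lf : IwasawaAlgebra 3}

/-- **The limit argument.** If every combination `Y_m = u_m L♯ + v_m L♭` satisfies
`Y_m(T^ι) − σ(1+T)^c Y_m ∈ ω_m Λ`, then each trace coordinate `G_j = L♯ ℒ_{0j} + L♭ ℒ_{1j}` satisfies
`G_j(T^ι) = σ(1+T)^c G_j` in `ℚ_3⟦T⟧`: the defect of the `n`-th approximant is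
`ω_{n+1}e_{n+1}(C^{−(n+2)})_{0j} + ω_n e_n (C^{−(n+2)})_{1j}`, whose `k`-th coefficient has norm
`≤ 3^{⌊log₃ k⌋+2−⌊n/2⌋} → 0`, while it tends to the `k`-th coefficient of the defect of `G_j`.
[cite: Sprung2017, Thm. 1.1, §3.1 Lemma 3.3 and Thm. 4.13] -/
theorem subst_traceCoordinate_eq_of_forall_exists
    (he : ∀ m : ℕ, ∃ e : IwasawaAlgebra 3,
      (toIwasawa 3 (sharpPoly (3 * b) 3 m) * Ls + toIwasawa 3 (flatPoly (3 * b) 3 m) * Lf).subst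
          (invOnePlusSubOne : ℤ_[3]⟦X⟧) -
        (σ : IwasawaAlgebra 3) * PowerSeries.binomialSeries ℤ_[3] c *
          (toIwasawa 3 (sharpPoly (3 * b) 3 m) * Ls + toIwasawa 3 (flatPoly (3 * b) 3 m) * Lf) =
      ((1 + X : ℤ_[3]⟦X⟧) ^ (3 ^ m) - 1) * e)
    (j : Fin 2) :
    PowerSeries.subst (invOnePlusSubOne : ℚ_[3]⟦X⟧)
        (iwasawaToPowerSeries 3 Ls * halfLogMatrix b 0 j + iwasawaToPowerSeries 3 Lf * halfLogMatrix b 1 j) =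
      (σ : PowerSeries ℚ_[3]) * (PowerSeries.binomialSeries ℤ_[3] c).map (algebraMap ℤ_[3] ℚ_[3]) *
        (iwasawaToPowerSeries 3 Ls * halfLogMatrix b 0 j + iwasawaToPowerSeries 3 Lf * halfLogMatrix b 1 j) := by
  have hιK := hasSubst_invOnePlusSubOne (R := ℚ_[3])
  set κ : ℚ_[3]⟦X⟧ := (σ : PowerSeries ℚ_[3]) *
    (PowerSeries.binomialSeries ℤ_[3] c).map (algebraMap ℤ_[3] ℚ_[3]) with hκ
  set G : ℚ_[3]⟦X⟧ := iwasawaToPowerSeries 3 Ls * halfLogMatrix b 0 j +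
    iwasawaToPowerSeries 3 Lf * halfLogMatrix b 1 j with hG
  -- the defects of the `Y_m`, read in `ℚ_3⟦T⟧`
  choose e he using he
  have hE : ∀ m : ℕ,
      (iwasawaToPowerSeries 3 (toIwasawa 3 (sharpPoly (3 * b) 3 m) * Ls +
          toIwasawa 3 (flatPoly (3 * b) 3 m) * Lf)).subst (invOnePlusSubOne : ℚ_[3]⟦X⟧) -
        κ * iwasawaToPowerSeries 3 (toIwasawa 3 (sharpPoly (3 * b) 3 m) * Ls +
          toIwasawa 3 (flatPoly (3 * b) 3 m) * Lf) =
      iwasawaToPowerSeries 3 (((1 + X : ℤ_[3]⟦X⟧) ^ (3 ^ m) - 1) * e m) := by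
    intro m
    have h := congrArg (iwasawaToPowerSeries 3) (he m)
    rw [map_sub, map_mul, map_mul, map_intCast, iwasawaToPowerSeries_subst_invOnePlusSubOne] at h
    rw [hκ, ← h]
  -- the approximants and their defects
  set g : ℕ → ℚ_[3]⟦X⟧ := fun n => iwasawaToPowerSeries 3 Ls *
        ((((halfLogApprox 3 (3 * b) n 0 j).map (algebraMap ℚ ℚ_[3])) : Polynomial ℚ_[3]) : ℚ_[3]⟦X⟧) +
      iwasawaToPowerSeries 3 Lf *
        ((((halfLogApprox 3 (3 * b) n 1 j).map (algebraMap ℚ ℚ_[3])) : Polynomial ℚ_[3]) : ℚ_[3]⟦X⟧)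
    with hg
  have hdef : ∀ n : ℕ, (g n).subst (invOnePlusSubOne : ℚ_[3]⟦X⟧) - κ * g n =
      iwasawaToPowerSeries 3 (((1 + X : ℤ_[3]⟦X⟧) ^ (3 ^ (n + 1)) - 1) * e (n + 1)) *
          PowerSeries.C ((((sprungCinv 3 (3 * b)) ^ (n + 2)) 0 j : ℚ) : ℚ_[3]) +
        iwasawaToPowerSeries 3 (((1 + X : ℤ_[3]⟦X⟧) ^ (3 ^ n) - 1) * e n) *
          PowerSeries.C ((((sprungCinv 3 (3 * b)) ^ (n + 2)) 1 j : ℚ) : ℚ_[3]) := by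
    intro n
    rw [← hE (n + 1), ← hE n, hg]
    simp only
    rw [sum_mul_coe_map_halfLogApprox, ← coe_substAlgHom hιK, map_add, map_mul, map_mul,
      C_eq_algebraMap, C_eq_algebraMap, AlgHom.commutes, AlgHom.commutes, coe_substAlgHom hιK]
    ring
  -- every coefficient of the defect of `G` vanishes
  have hcoeff : ∀ k : ℕ, coeff k (G.subst (invOnePlusSubOne : ℚ_[3]⟦X⟧) - κ * G) = 0 := by
    intro k
    have hlim : Tendsto (fun n => coeff k ((g n).subst (invOnePlusSubOne : ℚ_[3]⟦X⟧) - κ * g n)) atTop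
        (𝓝 (coeff k (G.subst (invOnePlusSubOne : ℚ_[3]⟦X⟧) - κ * G))) :=
      tendsto_coeff_defect κ (fun k' => tendsto_coeff_sum_mul_coe_map_halfLogApprox b Ls Lf j k') k
    have hzero : Tendsto (fun n => coeff k ((g n).subst (invOnePlusSubOne : ℚ_[3]⟦X⟧) - κ * g n)) atTop
        (𝓝 0) := by
      refine tendsto_zero_iff_norm_tendsto_zero.mpr
        (squeeze_zero (fun n => norm_nonneg _) (fun n => ?_) (tendsto_tailBound k))
      rw [hdef n, map_add]
      refine (Padic.nonarchimedean _ _).trans (max_le ?_ ?_)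
      · exact norm_coeff_omega_mul_mul_C_le (Nat.le_succ n) k (e (n + 1)) (norm_sprungCinv_pow_le b n 0 j)
      · exact norm_coeff_omega_mul_mul_C_le le_rfl k (e n) (norm_sprungCinv_pow_le b n 1 j)
    exact tendsto_nhds_unique hlim hzero
  have hzero : G.subst (invOnePlusSubOne : ℚ_[3]⟦X⟧) - κ * G = 0 := by
    ext k
    rw [hcoeff k, map_zero]
  exact sub_eq_zero.mp hzero

/-- `ι` is determined by `(1 + T)(ι + 1) = 1` (private plumbing). [folklore] -/
private theorem eq_invOnePlusSubOne_of_mul_eq_one {ι : ℚ_[3]⟦X⟧} (hι : (1 + X : ℚ_[3]⟦X⟧) * (ι + 1) = 1) :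
    ι = invOnePlusSubOne := by
  have h0 := one_add_X_mul_invOnePlusSubOne_add_one (R := ℚ_[3])
  have hne : (1 + X : ℚ_[3]⟦X⟧) ≠ 0 := by
    intro h
    have := congrArg constantCoeff h
    rw [map_add, map_one, constantCoeff_X, map_zero] at this
    norm_num at this
  have h := mul_left_cancel₀ hne (hι.trans h0.symm)
  exact add_right_cancel h

/-- **Sprung 2017, Thm. 1.1 + Thm. 4.13 / Cor. 4.14 (Mazur–Tate–Teitelbaum §I.17) at `(3, ±3)` — the
functional equation of the trace coordinates, PROVED**: the named fact
`thm413_traceCoordinate_functionalEquation_three` holds. Ingredients: `3`-integrality of the plus symbols at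
`a_3 = ±3` (`norm_ratPlusSymbol_div_pow_le_one_of_not_dvd`, Cor. 4.10), the finite-level functional
equation transported to `Y_n = u_n L♯ + v_n L♭` (`IsSprungPair.exists_subst_sub_mul_eq_omega_mul`), and the
limit argument `subst_traceCoordinate_eq_of_forall_exists`.
[cite: Sprung2017, Thm. 1.1, Thm. 4.13 and Cor. 4.14 (with Cor. 4.4, Cor. 4.10)]
[cite: MazurTateTeitelbaum1986Invent, §I.17] -/
theorem thm413_traceCoordinate_functionalEquation_three_holds :
    thm413_traceCoordinate_functionalEquation_three := by
  intro W _ _ N _ f b hb hf hgood hab σ hσ hW ηN c hc ι hι Ls Lf hSP j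
  obtain rfl : ι = invOnePlusSubOne := eq_invOnePlusSubOne_of_mul_eq_one hι
  -- `3 ∤ N`, `a_3(f) = 3b ≢ 1 (mod 3)`: the plus symbols are `3`-integral
  have hpN : ¬ 3 ∣ N := not_dvd_level_of_isNewformOf hf hgood
  have hap : cuspCoeff f 3 = ((3 * b : ℤ) : ℂ) := by
    rw [cuspCoeff_eq_frobeniusTrace_of_isNewformOf_holds hf hgood, hab]
  have hpa : ¬ ((3 : ℕ) : ℤ) ∣ 3 * b - 1 := by
    rintro ⟨k, hk⟩
    omega
  have hint : ∀ a k : ℕ, ‖((ratPlusSymbol f ((a : ℚ) / ((3 : ℕ) : ℚ) ^ k) : ℚ) : ℚ_[3])‖ ≤ 1 :=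
    fun a k => norm_ratPlusSymbol_div_pow_le_one_of_not_dvd (p := 3) (by norm_num) hf.1 hpN hap hpa a k
  exact subst_traceCoordinate_eq_of_forall_exists
    (fun m => hSP.exists_subst_sub_mul_eq_omega_mul hint hσ hW hc m) j

end Main

end Literature.NumberTheory.EllipticCurves.Sprung2017

end
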